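import Summits.PneNP.PneNP.Theorems.SymmetryBudgetNoHiddenOrderWindowSound

/-!
# `NoHiddenOrder` (stmt-PneNP-14781), (R2c): `GraphProgram.sound` from a GOOD root value — no valuation parameters in the statement

Route `PneNP/SymmetryBudget`; continues `…WindowSound.lean`.  The compiler's output wires read the bit readout `outB` of the value `E` of the
root group; by `CertifiedLabels.val_sound` that value is `Good` for the start instance, whatever width `n ≥ |W|`, admissibility predicate and
fuel the program was built with.  So the robust interface for the `sound` field is in terms of `Good` alone:

* **`window_sound_of_good`** — process on the window type `↥W` (`W = windowSet m`), ANY start colouring `c` with colours `< n` separating outside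
  signatures (`hsig`): `Good ((rootGraph x).comap Subtype.val) n ⟨(univ, c), _⟩ E → ∃ ρ ∈ Bud(m,⌊log₂ m⌋), fromRel (outB … (extendCol W c) E) =
  fromRel (x ∘ ρ×ρ)`;
* `window_sound_of_good_refineIn` — the same for the refined start colouring `refineIn _ univ c₀` of any `c₀` with `hsig₀` (e.g. the `rankIn`
  colouring of a `VecCmp` over owners `↥W` on the signature wires, `GraphReadout.hsig_rankIn_subtype`), at any width `n ≥ |W|`;
* `window_good_root` — and such a good root value EXISTS for the generic replay decoding, the bit valuation of any width `n ≥ |W|` and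
  admissibility `AdmB (4|W| + ⌊log₂|W|⌋)` (any fuel-free restatement of `window_root_subtype`).
Sorry-free; supports stmt-PneNP-14781, does not close it.
-/

set_option linter.dupNamespace false -- `Summit.PneNP.PneNP.…` (D-0017 single-conjunct layout)

namespace Summit.PneNP.PneNP.Theorems

open Finset CGBits BranchSum GraphReadout Literature.Computability.Complexity
open Summit.PneNP.PneNP.Theses.SymmetryBudget

namespace GraphReadout

variable {m : ℕ}

/-- **`GraphProgram.sound` from a good root value** (window type, any start colouring with representable colours separating outside
signatures, any width `n ≥ |W|`). [folklore] -/
theorem window_sound_of_good (x : Fin m × Fin m → Bool) {W : Finset (Fin m)} (hW : W = windowSet m) (hne : (univ : Finset ↥W).Nonempty)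
    {n : ℕ} (hWn : W.card ≤ n) (c : ↥W → ℕ) (hc : ∀ u, c u < n)
    (hsig : ∀ u v : ↥W, c u = c v → ∀ i, i ∉ W → ((rootGraph x).Adj i u ↔ (rootGraph x).Adj i v)) {E : BVal n}
    (hgood : Good ((rootGraph x).comap Subtype.val) n (⟨(univ, c), hne⟩ : CGInst ↥W) E) :
    ∃ ρ ∈ pointStabiliserBudget m (Nat.log 2 m),
      (SimpleGraph.fromRel fun u v => outB W hWn (rootGraph x) (extendCol W c) E (u, v) = true) =
        SimpleGraph.fromRel fun u v => x (ρ u, ρ v) = true := by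
  have hwf : Wf n (⟨(univ, c), hne⟩ : CGInst ↥W) := fun u _ => hc u
  obtain ⟨e, he, rfl⟩ := (good_iff_of_wf hwf).1 hgood
  refine outB_sound_matrix hW x (fun u hu v hv h i hi => ?_) (rowData_of_isEnum_subtype he hc)
  have h' : c ⟨u, hu⟩ = c ⟨v, hv⟩ := by simpa [extendCol, hu, hv] using h
  exact hsig ⟨u, hu⟩ ⟨v, hv⟩ h' i hi

/-- **The same for a refined start colouring** `refineIn _ univ c₀`, `c₀` separating outside signatures. [folklore] -/
theorem window_sound_of_good_refineIn (x : Fin m × Fin m → Bool) {W : Finset (Fin m)} (hW : W = windowSet m)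
    (hne : (univ : Finset ↥W).Nonempty) {n : ℕ} (hWn : W.card ≤ n) (c₀ : ↥W → ℕ)
    (hsig₀ : ∀ u v : ↥W, c₀ u = c₀ v → ∀ i, i ∉ W → ((rootGraph x).Adj i u ↔ (rootGraph x).Adj i v)) {E : BVal n}
    (hgood : Good ((rootGraph x).comap Subtype.val) n
      (⟨(univ, refineIn ((rootGraph x).comap Subtype.val) univ c₀), hne⟩ : CGInst ↥W) E) :
    ∃ ρ ∈ pointStabiliserBudget m (Nat.log 2 m),
      (SimpleGraph.fromRel fun u v =>
          outB W hWn (rootGraph x) (extendCol W (refineIn ((rootGraph x).comap Subtype.val) univ c₀)) E (u, v) = true) =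
        SimpleGraph.fromRel fun u v => x (ρ u, ρ v) = true := by
  refine window_sound_of_good x hW hne hWn _ (fun u => ?_) (fun u v h i hi => ?_) hgood
  · have h1 := refineIn_lt_card (G := (rootGraph x).comap Subtype.val) c₀ (mem_univ u)
    rw [card_univ, Fintype.card_coe] at h1
    exact h1.trans_le hWn
  · exact hsig₀ u v (refineIn_refines c₀ (mem_univ _) (mem_univ _) h) i hi

/-- **A good root value exists** — generic replay decoding, bit valuation of any width `n ≥ |W|`, admissibility `AdmB (4|W| + ⌊log₂|W|⌋)` (in
`Fintype.card ↥W`), any equitable well-formed start `⟨(univ, refineIn _ univ c₀), _⟩`; fuel `Fintype.card ↥W`. [folklore] -/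
theorem window_good_root (G : SimpleGraph (Fin m)) [DecidableRel G.Adj] {W : Finset (Fin m)} (hne : (univ : Finset ↥W).Nonempty)
    {n : ℕ} (hn : Fintype.card ↥W ≤ n) (c₀ : ↥W → ℕ) :
    ∃ E, CertifiedLabels.val (cgProcess (G.comap Subtype.val)) (bitValuation (G.comap Subtype.val) n hn)
        (fun L => CertifiedLabels.replay (cgProcess (G.comap Subtype.val)) L ⟨(univ, refineIn (G.comap Subtype.val) univ c₀), hne⟩ ∅)
        (fun L => AdmB (4 * Fintype.card ↥W + Nat.log 2 (Fintype.card ↥W)) L.X L.lam) (Fintype.card ↥W) ⟨univ, ∅, fun _ => 0⟩ =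
          some E ∧
      Good (G.comap Subtype.val) n (⟨(univ, refineIn (G.comap Subtype.val) univ c₀), hne⟩ : CGInst ↥W) E :=
  cg_root_good_replay_admB_refineIn (bitValuation (G.comap Subtype.val) n hn) hne c₀

end GraphReadout

end Summit.PneNP.PneNP.Theorems
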